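import Literature.Analysis.FluidPDE.PassiveVectorTensorClass
import Literature.Analysis.FluidPDE.PassiveVectorSuperposition
import HarnessLib

/-!
# Superposition of weak TENSOR-viscosity passive-vector solutions on `T^d`

Analysis/FluidPDE proof-support file (everything proved; no new definitions, no named facts): the tensor twin
of §1 of `PassiveVectorSuperposition`.  For the weak class `Torus.IsWeakTensorPassiveVectorOn A T 𝔸 b w₀ w` of
`PassiveVectorTensor.lean` (Frisch's anisotropic-eddy-viscosity passive-vector equation (9.57),
`∂ₜw + (b·∇)w + A (w·∇)b + ∇π = 𝓛_𝔸 w`, `∇·w = 0`, constant fourth-order tensor `𝔸`, weak form tested against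
divergence-free fields as in DiPerna–Lions 1989 §II.1):

* `IsWeakTensorPassiveVectorOn.add` — the sum of two weak solutions with the same carrier, coupling and tensor is
  a weak solution for the sum of the (integrable) data; `const_smul`, `neg`, `sub`, `finset_sum` — linearity of the
  weak formulation; the bookkeeping clauses (`L^∞_t L²_x`, `‖b‖‖w‖ ∈ L¹`, weak divergence-freeness) are closed under
  sums (`lintegral_mul_add_lt_top`, `ae_lintegral_sq_add_le`).

(`PassiveVectorTensorUniqueness.sub_of_eq` is the special case of `sub` with EQUAL data.)  The orthogonality half
(§2 of the scalar file: frequency-disjoint `L²` fields are orthogonal, energies of frequency-disjoint families add) is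
class-independent and is re-exported by the import.  Consumers: the Bloch-sector decomposition of the TENSOR cell
problem of the K1L stubs `stub_cellEnergyT` / `stub_cellLawV` / `stub_oneLevelL` (route
`SolenoidalFractalHomogenisation`, cell `ad-ideate`): data split into frequency classes `ℓ + nℤ^d`, one solution
per class, summed here; sector preservation of EVERY weak solution then follows from translation covariance +
uniqueness (`PassiveVectorTensorUniqueness.ae_eq_of_memLp_top`).

## Mathlib / tree search

Tree: `PassiveVectorSuperposition` (scalar twin, VERBATIM template; also supplies
`IsWeaklyDivFree.add_of_integrable` / `.const_smul'`), `PassiveVectorTensorClass` (class API: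
`integrable_weakIntegrand`, `ae_memLp_two`, `exists_eLpNorm_le`, `aestronglyMeasurable_uncurry(_carrier)`),
`PassiveVectorTensorUniqueness.sub_of_eq`.  No additivity lemma for the tensor class existed (2026-08-28).

## References

* R. J. DiPerna, P.-L. Lions, Invent. Math. 98 (1989) 511–547, §II.1 (12)–(14). [`DiPernaLions1989`]
* U. Frisch, *Turbulence* (CUP 1995), §9.6.3 eq. (9.57) p. 233. [`Frisch1995Turbulence`]
* K. Yoshida, Y. Kaneda, Phys. Rev. E 63 (2000) 016308, §II eq. (4)–(5). [`YoshidaKaneda2000`]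
-/

noncomputable section

open MeasureTheory TopologicalSpace Set Function Filter Topology UnitAddTorus
open scoped ENNReal NNReal InnerProductSpace

namespace Literature.Analysis.FluidPDE

namespace Torus

variable {d : Type*} [Fintype d] [DecidableEq d]

section Superposition

namespace IsWeakTensorPassiveVectorOn

variable {A T : ℝ} {𝔸 : Visc4 d} {b u v : ℝ → UnitAddTorus d → EuclideanSpace ℝ d}
  {u₀ v₀ : UnitAddTorus d → EuclideanSpace ℝ d}

/-- `‖b‖ ‖u + v‖ ∈ L¹((0,T) × T^d)` for two weak solutions with the same carrier
(iterated-`lintegral` form of the class). [cite: DiPernaLions1989, §II.1 (12)–(14)] -/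
theorem lintegral_mul_add_lt_top (h₁ : IsWeakTensorPassiveVectorOn A T 𝔸 b u₀ u)
    (h₂ : IsWeakTensorPassiveVectorOn A T 𝔸 b v₀ v) :
    ∫⁻ t in Ioo 0 T, ∫⁻ x, ‖b t x‖ₑ * ‖u t x + v t x‖ₑ < ⊤ := by
  set μT : Measure ℝ := (volume : Measure ℝ).restrict (Ioo 0 T) with hμT
  have hmu := h₁.aestronglyMeasurable_uncurry_carrier
  have hm₁ := h₁.aestronglyMeasurable_uncurry
  have hm₂ := h₂.aestronglyMeasurable_uncurry
  have hF : AEMeasurable (fun p : ℝ × UnitAddTorus d => ‖b p.1 p.2‖ₑ * ‖u p.1 p.2 + v p.1 p.2‖ₑ)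
      (μT.prod volume) := hmu.enorm.mul (hm₁.add hm₂).enorm
  have hF₁ : AEMeasurable (fun p : ℝ × UnitAddTorus d => ‖b p.1 p.2‖ₑ * ‖u p.1 p.2‖ₑ) (μT.prod volume) :=
    hmu.enorm.mul hm₁.enorm
  have hF₂ : AEMeasurable (fun p : ℝ × UnitAddTorus d => ‖b p.1 p.2‖ₑ * ‖v p.1 p.2‖ₑ) (μT.prod volume) :=
    hmu.enorm.mul hm₂.enorm
  have e : ∫⁻ t in Ioo 0 T, ∫⁻ x, ‖b t x‖ₑ * ‖u t x + v t x‖ₑ =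
      ∫⁻ p, ‖b p.1 p.2‖ₑ * ‖u p.1 p.2 + v p.1 p.2‖ₑ ∂(μT.prod volume) := (lintegral_prod _ hF).symm
  rw [e]
  calc ∫⁻ p, ‖b p.1 p.2‖ₑ * ‖u p.1 p.2 + v p.1 p.2‖ₑ ∂(μT.prod volume)
      ≤ ∫⁻ p, (‖b p.1 p.2‖ₑ * ‖u p.1 p.2‖ₑ + ‖b p.1 p.2‖ₑ * ‖v p.1 p.2‖ₑ) ∂(μT.prod volume) := by
        refine lintegral_mono fun p => ?_
        rw [← mul_add]
        gcongr
        exact enorm_add_le _ _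
    _ = (∫⁻ p, ‖b p.1 p.2‖ₑ * ‖u p.1 p.2‖ₑ ∂(μT.prod volume)) +
          ∫⁻ p, ‖b p.1 p.2‖ₑ * ‖v p.1 p.2‖ₑ ∂(μT.prod volume) := lintegral_add_left' hF₁ _
    _ = (∫⁻ t in Ioo 0 T, ∫⁻ x, ‖b t x‖ₑ * ‖u t x‖ₑ) + ∫⁻ t in Ioo 0 T, ∫⁻ x, ‖b t x‖ₑ * ‖v t x‖ₑ := by
        rw [lintegral_prod _ hF₁, lintegral_prod _ hF₂]
    _ < ⊤ := ENNReal.add_lt_top.2 ⟨h₁.lintegral_mul_lt_top, h₂.lintegral_mul_lt_top⟩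

/-- `u + v ∈ L^∞(0,T; L²)`: `∫ ‖u(t) + v(t)‖² ≤ (C₁ + C₂)²` for a.e. `t`. [cite: DiPernaLions1989, §II.1 (12)–(14)] -/
theorem ae_lintegral_sq_add_le (h₁ : IsWeakTensorPassiveVectorOn A T 𝔸 b u₀ u)
    (h₂ : IsWeakTensorPassiveVectorOn A T 𝔸 b v₀ v) :
    ∃ C : ℝ≥0, ∀ᵐ t ∂(volume.restrict (Ioo 0 T)), ∫⁻ x, ‖u t x + v t x‖ₑ ^ 2 ≤ C := by
  obtain ⟨C₁, hC₁⟩ := h₁.exists_eLpNorm_le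
  obtain ⟨C₂, hC₂⟩ := h₂.exists_eLpNorm_le
  refine ⟨(C₁ + C₂) ^ 2, ?_⟩
  filter_upwards [hC₁, hC₂, h₁.ae_memLp_two, h₂.ae_memLp_two] with t hc₁ hc₂ hm₁ hm₂
  have hadd : eLpNorm (u t + v t) 2 volume ≤ C₁ + C₂ :=
    (eLpNorm_add_le hm₁.1 hm₂.1 one_le_two).trans (add_le_add hc₁ hc₂)
  have e : ∫⁻ x, ‖u t x + v t x‖ₑ ^ 2 = eLpNorm (u t + v t) 2 volume ^ 2 := by
    rw [eLpNorm_eq_lintegral_rpow_enorm_toReal two_ne_zero ENNReal.ofNat_ne_top, ENNReal.toReal_ofNat,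
      ← ENNReal.rpow_natCast, ← ENNReal.rpow_mul]
    norm_num
  rw [e, ENNReal.coe_pow, ENNReal.coe_add]
  exact pow_le_pow_left' hadd 2

/-- **Superposition (additivity) of weak TENSOR-viscosity passive-vector solutions.** If `u`, `v` are weak solutions
of `∂ₜw + (b·∇)w + A (w·∇)b + ∇π = 𝓛_𝔸 w`, `∇·w = 0` on `T^d × [0,T)` with the same carrier `b`,
coupling `A` and constant viscosity tensor `𝔸`, from integrable data `u₀`, `v₀`, then `u + v` is a weak solution from
`u₀ + v₀`: the weak formulation (Yoshida–Kaneda 2000 (4)–(5) tested against divergence-free fields,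
DiPerna–Lions 1989 §II.1) is linear in the pair (datum, solution), and the bookkeeping clauses are closed
under sums (`lintegral_mul_add_lt_top`, `ae_lintegral_sq_add_le`). Integrability of the data is needed to
split the datum pairing `∫⟪u₀ + v₀, Ψ(0)⟫`. [cite: DiPernaLions1989, §II.1 (12)–(14)] -/
theorem add (h₁ : IsWeakTensorPassiveVectorOn A T 𝔸 b u₀ u) (h₂ : IsWeakTensorPassiveVectorOn A T 𝔸 b v₀ v)
    (hu₀ : Integrable u₀ volume) (hv₀ : Integrable v₀ volume) :
    IsWeakTensorPassiveVectorOn A T 𝔸 b (fun x => u₀ x + v₀ x) (fun t x => u t x + v t x) where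
  aestronglyMeasurable := h₁.aestronglyMeasurable.add h₂.aestronglyMeasurable
  aestronglyMeasurable_carrier := h₁.aestronglyMeasurable_carrier
  ae_lintegral_sq_le := ae_lintegral_sq_add_le h₁ h₂
  lintegral_carrier_lt_top := h₁.lintegral_carrier_lt_top
  lintegral_mul_lt_top := lintegral_mul_add_lt_top h₁ h₂
  ae_isWeaklyDivFree_carrier := h₁.ae_isWeaklyDivFree_carrier
  ae_isWeaklyDivFree := by
    filter_upwards [h₁.ae_isWeaklyDivFree, h₂.ae_isWeaklyDivFree, h₁.ae_memLp_two, h₂.ae_memLp_two]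
      with t hd₁ hd₂ hm₁ hm₂
    exact hd₁.add_of_integrable hd₂ (hm₁.integrable one_le_two) (hm₂.integrable one_le_two)
  weak_eq Ψ hΨ hΨdiv := by
    have e₁ := h₁.weak_eq Ψ hΨ hΨdiv
    have e₂ := h₂.weak_eq Ψ hΨ hΨdiv
    have hI₁ := h₁.integrable_weakIntegrand hΨ
    have hI₂ := h₂.integrable_weakIntegrand hΨ
    have hpt : ∀ t x, ⟪u t x + v t x, FunctionSpaces.Torus.timeDeriv Ψ t x +
          FunctionSpaces.Torus.convect (b t) (Ψ t) x + viscAdj 𝔸 (Ψ t) x⟫_ℝ +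
        A * ⟪b t x, FunctionSpaces.Torus.convect (fun y => u t y + v t y) (Ψ t) x⟫_ℝ =
        (⟪u t x, FunctionSpaces.Torus.timeDeriv Ψ t x +
            FunctionSpaces.Torus.convect (b t) (Ψ t) x + viscAdj 𝔸 (Ψ t) x⟫_ℝ +
          A * ⟪b t x, FunctionSpaces.Torus.convect (u t) (Ψ t) x⟫_ℝ) +
        (⟪v t x, FunctionSpaces.Torus.timeDeriv Ψ t x +
            FunctionSpaces.Torus.convect (b t) (Ψ t) x + viscAdj 𝔸 (Ψ t) x⟫_ℝ +
          A * ⟪b t x, FunctionSpaces.Torus.convect (v t) (Ψ t) x⟫_ℝ) := by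
      intro t x
      simp only [FunctionSpaces.Torus.convect, map_add, inner_add_left, inner_add_right]
      ring
    have hslice : ∀ᵐ t ∂(volume.restrict (Ioo 0 T)),
        ∫ x, (⟪u t x + v t x, FunctionSpaces.Torus.timeDeriv Ψ t x +
            FunctionSpaces.Torus.convect (b t) (Ψ t) x + viscAdj 𝔸 (Ψ t) x⟫_ℝ +
          A * ⟪b t x, FunctionSpaces.Torus.convect (fun y => u t y + v t y) (Ψ t) x⟫_ℝ) =
        (∫ x, (⟪u t x, FunctionSpaces.Torus.timeDeriv Ψ t x +
            FunctionSpaces.Torus.convect (b t) (Ψ t) x + viscAdj 𝔸 (Ψ t) x⟫_ℝ +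
          A * ⟪b t x, FunctionSpaces.Torus.convect (u t) (Ψ t) x⟫_ℝ)) +
        ∫ x, (⟪v t x, FunctionSpaces.Torus.timeDeriv Ψ t x +
            FunctionSpaces.Torus.convect (b t) (Ψ t) x + viscAdj 𝔸 (Ψ t) x⟫_ℝ +
          A * ⟪b t x, FunctionSpaces.Torus.convect (v t) (Ψ t) x⟫_ℝ) := by
      filter_upwards [hI₁.prod_right_ae, hI₂.prod_right_ae] with t ht₁ ht₂
      rw [← integral_add ht₁ ht₂]
      exact integral_congr_ae (Eventually.of_forall fun x => hpt t x)
    -- the datum pairing splits: `Ψ 0` is continuous and the data are integrable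
    have hΨ0 : Continuous (Ψ 0) := (hΨ.isSmooth_slice 0).continuous
    have hd : ∫ x, ⟪u₀ x + v₀ x, Ψ 0 x⟫_ℝ = (∫ x, ⟪u₀ x, Ψ 0 x⟫_ℝ) + ∫ x, ⟪v₀ x, Ψ 0 x⟫_ℝ := by
      simp_rw [inner_add_left]
      exact integral_add (FunctionSpaces.Torus.integrable_inner_of_continuous hu₀ hΨ0)
        (FunctionSpaces.Torus.integrable_inner_of_continuous hv₀ hΨ0)
    rw [integral_congr_ae hslice, integral_add hI₁.integral_prod_left hI₂.integral_prod_left, hd]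
    linarith

/-- **Constant multiples of weak tensor-viscosity passive-vector solutions** are weak solutions for the multiplied
datum (linearity of Yoshida–Kaneda (4)–(5) in weak form). [cite: DiPernaLions1989, §II.1 (12)–(14)] -/
theorem const_smul (h₁ : IsWeakTensorPassiveVectorOn A T 𝔸 b u₀ u) (c : ℝ) :
    IsWeakTensorPassiveVectorOn A T 𝔸 b (fun x => c • u₀ x) (fun t x => c • u t x) where
  aestronglyMeasurable := h₁.aestronglyMeasurable.const_smul c
  aestronglyMeasurable_carrier := h₁.aestronglyMeasurable_carrier
  ae_lintegral_sq_le := by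
    obtain ⟨C, hC⟩ := h₁.ae_lintegral_sq_le
    refine ⟨‖c‖₊ ^ 2 * C, ?_⟩
    filter_upwards [hC] with t ht
    have e : ∫⁻ x, ‖c • u t x‖ₑ ^ 2 = (‖c‖₊ : ℝ≥0∞) ^ 2 * ∫⁻ x, ‖u t x‖ₑ ^ 2 := by
      rw [← lintegral_const_mul' _ _ (by simp)]
      refine lintegral_congr fun x => ?_
      rw [enorm_smul, mul_pow]
      rfl
    rw [e, ENNReal.coe_mul, ENNReal.coe_pow]
    gcongr
  lintegral_carrier_lt_top := h₁.lintegral_carrier_lt_top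
  lintegral_mul_lt_top := by
    have e : ∫⁻ t in Ioo 0 T, ∫⁻ x, ‖b t x‖ₑ * ‖c • u t x‖ₑ =
        (‖c‖₊ : ℝ≥0∞) * ∫⁻ t in Ioo 0 T, ∫⁻ x, ‖b t x‖ₑ * ‖u t x‖ₑ := by
      rw [← lintegral_const_mul' _ _ (by simp)]
      refine lintegral_congr fun t => ?_
      rw [← lintegral_const_mul' _ _ (by simp)]
      refine lintegral_congr fun x => ?_
      rw [enorm_smul]
      simp only [mul_left_comm]
      rfl
    rw [e]
    exact ENNReal.mul_lt_top (by simp) h₁.lintegral_mul_lt_top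
  ae_isWeaklyDivFree_carrier := h₁.ae_isWeaklyDivFree_carrier
  ae_isWeaklyDivFree := by
    filter_upwards [h₁.ae_isWeaklyDivFree] with t hd₁
    exact hd₁.const_smul' c
  weak_eq Ψ hΨ hΨdiv := by
    have e₁ := h₁.weak_eq Ψ hΨ hΨdiv
    have hI₁ := h₁.integrable_weakIntegrand hΨ
    have hpt : ∀ t x, ⟪c • u t x, FunctionSpaces.Torus.timeDeriv Ψ t x +
          FunctionSpaces.Torus.convect (b t) (Ψ t) x + viscAdj 𝔸 (Ψ t) x⟫_ℝ +
        A * ⟪b t x, FunctionSpaces.Torus.convect (fun y => c • u t y) (Ψ t) x⟫_ℝ =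
        c * (⟪u t x, FunctionSpaces.Torus.timeDeriv Ψ t x +
            FunctionSpaces.Torus.convect (b t) (Ψ t) x + viscAdj 𝔸 (Ψ t) x⟫_ℝ +
          A * ⟪b t x, FunctionSpaces.Torus.convect (u t) (Ψ t) x⟫_ℝ) := by
      intro t x
      simp only [FunctionSpaces.Torus.convect, map_smul, real_inner_smul_left, real_inner_smul_right]
      ring
    have hslice : ∀ᵐ t ∂(volume.restrict (Ioo 0 T)),
        ∫ x, (⟪c • u t x, FunctionSpaces.Torus.timeDeriv Ψ t x +
            FunctionSpaces.Torus.convect (b t) (Ψ t) x + viscAdj 𝔸 (Ψ t) x⟫_ℝ +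
          A * ⟪b t x, FunctionSpaces.Torus.convect (fun y => c • u t y) (Ψ t) x⟫_ℝ) =
        c * ∫ x, (⟪u t x, FunctionSpaces.Torus.timeDeriv Ψ t x +
            FunctionSpaces.Torus.convect (b t) (Ψ t) x + viscAdj 𝔸 (Ψ t) x⟫_ℝ +
          A * ⟪b t x, FunctionSpaces.Torus.convect (u t) (Ψ t) x⟫_ℝ) := by
      filter_upwards with t
      rw [← integral_const_mul]
      exact integral_congr_ae (Eventually.of_forall fun x => hpt t x)
    have hd : ∫ x, ⟪c • u₀ x, Ψ 0 x⟫_ℝ = c * ∫ x, ⟪u₀ x, Ψ 0 x⟫_ℝ := by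
      simp_rw [real_inner_smul_left]
      exact integral_const_mul _ _
    rw [integral_congr_ae hslice, integral_const_mul, hd, ← mul_add, e₁, mul_zero]

/-- **Finite superposition of weak tensor-viscosity passive-vector solutions**: for a non-empty finite family of weak
solutions `u i` from integrable data `u₀ i` (same carrier, coupling, viscosity tensor), `∑ᵢ u i` is a weak
solution from `∑ᵢ u₀ i`. (Non-emptiness: the class records the carrier's bookkeeping, which an empty sum
would have to supply by itself.) [cite: DiPernaLions1989, §II.1 (12)–(14)] -/
theorem finset_sum {ι : Type*} (s : Finset ι) (hs : s.Nonempty)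
    {U₀ : ι → UnitAddTorus d → EuclideanSpace ℝ d} {U : ι → ℝ → UnitAddTorus d → EuclideanSpace ℝ d}
    (hint : ∀ i ∈ s, Integrable (U₀ i) volume) (h : ∀ i ∈ s, IsWeakTensorPassiveVectorOn A T 𝔸 b (U₀ i) (U i)) :
    IsWeakTensorPassiveVectorOn A T 𝔸 b (fun x => ∑ i ∈ s, U₀ i x) (fun t x => ∑ i ∈ s, U i t x) := by
  classical
  induction hs using Finset.Nonempty.cons_induction with
  | singleton a =>
    simp only [Finset.sum_singleton]
    exact h a (Finset.mem_singleton_self a)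
  | cons a s ha hs ih =>
    simp only [Finset.sum_cons]
    have hint' : ∀ i ∈ s, Integrable (U₀ i) volume := fun i hi => hint i (Finset.mem_cons_of_mem hi)
    have h' : ∀ i ∈ s, IsWeakTensorPassiveVectorOn A T 𝔸 b (U₀ i) (U i) := fun i hi => h i (Finset.mem_cons_of_mem hi)
    have hsumint : Integrable (fun x => ∑ i ∈ s, U₀ i x) volume :=
      integrable_finsetSum s fun i hi => hint' i hi
    exact (h a (Finset.mem_cons_self a s)).add (ih hint' h') (hint a (Finset.mem_cons_self a s)) hsumint

/-- **Negatives of weak tensor-viscosity passive-vector solutions** are weak solutions for the negated datum.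
[cite: DiPernaLions1989, §II.1 (12)–(14)] -/
theorem neg (h₁ : IsWeakTensorPassiveVectorOn A T 𝔸 b u₀ u) :
    IsWeakTensorPassiveVectorOn A T 𝔸 b (fun x => -u₀ x) (fun t x => -u t x) := by
  have h := h₁.const_smul (-1)
  simp only [neg_smul, one_smul] at h
  exact h

/-- **Differences of weak tensor-viscosity passive-vector solutions** (general data): if `u`, `v` are weak
solutions from integrable data `u₀`, `v₀` (same carrier, coupling, tensor), `u − v` is a weak solution from
`u₀ − v₀`.  (`PassiveVectorTensorUniqueness.sub_of_eq` is the equal-data case, which needs no integrability.)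
[cite: DiPernaLions1989, §II.1 (12)–(14)] -/
theorem sub (h₁ : IsWeakTensorPassiveVectorOn A T 𝔸 b u₀ u) (h₂ : IsWeakTensorPassiveVectorOn A T 𝔸 b v₀ v)
    (hu₀ : Integrable u₀ volume) (hv₀ : Integrable v₀ volume) :
    IsWeakTensorPassiveVectorOn A T 𝔸 b (fun x => u₀ x - v₀ x) (fun t x => u t x - v t x) := by
  have h := h₁.add h₂.neg hu₀ hv₀.neg
  simp only [← sub_eq_add_neg] at h
  exact h

end IsWeakTensorPassiveVectorOn

end Superposition

end Torus

end Literature.Analysis.FluidPDE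

end
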